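import Literature.NumberTheory.Sieve.VinogradovExpSum
import Literature.NumberTheory.Sieve.RamanujanSum
import Literature.NumberTheory.Sieve.LinearEquationsInPrimesTransference
import HarnessLib

/-!
# The `W`-tricked von Mangoldt function on a minor arc (Green–Tao 2010, Thm. 7.2 at `s = 1`)

Topic `Literature/NumberTheory/Sieve`. Everything in this file is PROVED (no named facts). It is
the minor-arc half of the exponential-sum estimate `sup_α |∑_{n ≤ N} (Λ'_{b,W}(n) − 1) e(nα)| = o(N)`
(the level-`s = 1` content of Green–Tao, *Linear equations in primes*, Ann. of Math. 171 (2010),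
Thm. 7.2; GT2010 §12: "the case `s = 1` … can be obtained by the classical Hardy–Littlewood
method"), companion of `LinearEquationsInPrimesWTrickMajorArc.lean`.

The progression `m = Wn + b` is detected by the additive characters modulo `W`
(`progExpSum_eq`, from the orthogonality relation `Literature.NumberTheory.Sieve.RamanujanSum.sum_range_fourierChar_div`):

  `∑_{n ≤ N} Λ'(Wn+b) e(nα) = (1/W) ∑_{j<W} e(−b(α+j)/W) ∑_{b < m ≤ WN+b} Λ'(m) e(m(α+j)/W)`,

so that `‖∑_{n ≤ N} Λ'_{b,W}(n) e(nα)‖ ≤ max_j ‖∑_{p ≤ WN+b} (log p) e(p(α+j)/W)‖ + (log 4)·b`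
(`norm_sum_vonMangoldtW_mul_le`); each inner sum is the tree's `primeExpSumLog`, to which
Vinogradov's estimate `Literature.NumberTheory.Sieve.Vinogradov.vinogradov_primeExpSumLog_bound`
applies on minor arcs. The assembly (Dirichlet approximation, major/minor dichotomy, the
`o(N)` bookkeeping) is `LinearEquationsInPrimesWTrickExpSum.lean`.

## References

* [GreenTao2010] B. Green, T. Tao, *Linear equations in primes*, Ann. of Math. 171 (2010),
  1753–1850, Thm. 7.2 and §12 (arXiv:math/0606088).
* [Nathanson1996] M. B. Nathanson, *Additive Number Theory: The Classical Bases*, GTM 164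
  (Springer 1996), §8.1 (the set-up of the circle method for primes), Thm. 8.5 (Vinogradov).
-/

noncomputable section

open scoped FourierTransform
open Finset

namespace Literature.NumberTheory.Sieve

namespace WTrick

open RamanujanSum

/-! ### Exponential sums of `Λ'` over the progression `W n + b` -/

/-- `progExpSum W b N α = ∑_{n ≤ N} Λ'(W n + b) e(nα)` (so that
`∑_{n ≤ N} Λ'_{b,W}(n) e(nα) = (φ(W)/W) · progExpSum W b N α`). [folklore] -/
def progExpSum (W b N : ℕ) (α : ℝ) : ℂ :=
  ∑ n ∈ Icc 1 N, (vonMangoldtPrime (W * n + b) : ℂ) * (𝐞 ((n : ℝ) * α) : ℂ)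

/-- `windowSum W b N θ = ∑_{b < m ≤ WN + b} Λ'(m) e(mθ)`. [folklore] -/
def windowSum (W b N : ℕ) (θ : ℝ) : ℂ :=
  ∑ m ∈ Ioc b (W * N + b), (vonMangoldtPrime m : ℂ) * (𝐞 ((m : ℝ) * θ) : ℂ)

/-- `∑_{n ≤ N} Λ'_{b,W}(n) e(nα) = (φ(W)/W) progExpSum W b N α`. [folklore] -/
theorem sum_vonMangoldtW_mul_eq (W b N : ℕ) (α : ℝ) :
    ∑ n ∈ Icc 1 N, (vonMangoldtW W b n : ℂ) * (𝐞 ((n : ℝ) * α) : ℂ) =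
      ((Nat.totient W : ℝ) / W : ℝ) * progExpSum W b N α := by
  rw [progExpSum, Finset.mul_sum]
  refine Finset.sum_congr rfl fun n _ => ?_
  rw [vonMangoldtW]; push_cast; ring

/-- **Detecting the progression with additive characters modulo `W`.** For `0 ≤ b < W`:
`∑_{n ≤ N} Λ'(Wn+b) e(nα) = (1/W) ∑_{j < W} e(−b(α+j)/W) ∑_{b < m ≤ WN+b} Λ'(m) e(m(α+j)/W)`,
by the orthogonality relation `∑_{j<W} e(jk/W) = W·[W ∣ k]` (`sum_range_fourierChar_div`) and the
substitution `m = Wn + b`. [folklore] -/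
theorem progExpSum_eq {W b : ℕ} (hW : 0 < W) (hb : b < W) (N : ℕ) (α : ℝ) :
    progExpSum W b N α = (1 / W : ℂ) * ∑ j ∈ range W,
      (𝐞 (-((b : ℝ) * (α + j) / W)) : ℂ) * windowSum W b N ((α + j) / W) := by
  classical
  have hW0 : (W : ℝ) ≠ 0 := by exact_mod_cast hW.ne'
  have hWC : (W : ℂ) ≠ 0 := by exact_mod_cast hW.ne'
  -- combine the phases and swap the sums
  have h1 : ∑ j ∈ range W, (𝐞 (-((b : ℝ) * (α + j) / W)) : ℂ) * windowSum W b N ((α + j) / W) =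
      ∑ m ∈ Ioc b (W * N + b), (vonMangoldtPrime m : ℂ) *
        ((𝐞 (((m : ℝ) - b) * α / W) : ℂ) *
          ∑ j ∈ range W, (𝐞 ((j : ℝ) * (((m : ℤ) - b : ℤ) : ℝ) / W) : ℂ)) := by
    simp only [windowSum, Finset.mul_sum]
    rw [Finset.sum_comm]
    refine Finset.sum_congr rfl fun m _ => ?_
    refine Finset.sum_congr rfl fun j _ => ?_
    have : (𝐞 (-((b : ℝ) * (α + j) / W)) : ℂ) * (𝐞 ((m : ℝ) * ((α + j) / W)) : ℂ) =
        (𝐞 (((m : ℝ) - b) * α / W) : ℂ) * (𝐞 ((j : ℝ) * (((m : ℤ) - b : ℤ) : ℝ) / W) : ℂ) := by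
      rw [← Circle.coe_mul, ← AddChar.map_add_eq_mul, ← Circle.coe_mul, ← AddChar.map_add_eq_mul]
      congr 2; push_cast; ring
    calc (𝐞 (-((b : ℝ) * (α + j) / W)) : ℂ) * ((vonMangoldtPrime m : ℂ) * 𝐞 ((m : ℝ) * ((α + j) / W)))
        = (vonMangoldtPrime m : ℂ) * ((𝐞 (-((b : ℝ) * (α + j) / W)) : ℂ) * 𝐞 ((m : ℝ) * ((α + j) / W))) := by
          ring
      _ = _ := by rw [this]
  rw [h1]
  -- orthogonality
  have h2 : ∀ m : ℕ, ∑ j ∈ range W, (𝐞 ((j : ℝ) * (((m : ℤ) - b : ℤ) : ℝ) / W) : ℂ) =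
      if (W : ℤ) ∣ ((m : ℤ) - b) then (W : ℂ) else 0 := fun m =>
    sum_range_fourierChar_div hW.ne' _
  simp_rw [h2]
  rw [Finset.mul_sum]
  have h3 : ∑ m ∈ Ioc b (W * N + b), (1 / W : ℂ) * ((vonMangoldtPrime m : ℂ) *
      ((𝐞 (((m : ℝ) - b) * α / W) : ℂ) * (if (W : ℤ) ∣ ((m : ℤ) - b) then (W : ℂ) else 0))) =
      ∑ m ∈ (Ioc b (W * N + b)).filter (fun m : ℕ => (W : ℤ) ∣ ((m : ℤ) - b)),
        (vonMangoldtPrime m : ℂ) * (𝐞 (((m : ℝ) - b) * α / W) : ℂ) := by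
    rw [Finset.sum_filter]
    refine Finset.sum_congr rfl fun m _ => ?_
    split_ifs
    · field_simp
    · simp
  rw [h3, progExpSum]
  -- the substitution `m = W n + b`
  refine Finset.sum_nbij' (fun n => W * n + b) (fun m => m / W) ?_ ?_ ?_ ?_ ?_
  · intro n hn
    rw [Finset.mem_Icc] at hn
    rw [Finset.mem_filter, Finset.mem_Ioc]
    refine ⟨⟨?_, ?_⟩, ⟨n, ?_⟩⟩
    · have : 0 < W * n := Nat.mul_pos hW (by omega)
      omega
    · exact Nat.add_le_add_right (Nat.mul_le_mul_left W hn.2) b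
    · push_cast; ring
  · intro m hm
    rw [Finset.mem_filter, Finset.mem_Ioc] at hm
    obtain ⟨⟨hbm, hmX⟩, hdvd⟩ := hm
    have hmod : m % W = b := by
      have h := (Nat.modEq_iff_dvd.2 hdvd : b ≡ m [MOD W])
      rw [Nat.ModEq, Nat.mod_eq_of_lt hb] at h
      exact h.symm
    have hdm : W * (m / W) + b = m := by
      conv_rhs => rw [← Nat.div_add_mod m W]
      rw [hmod]
    rw [Finset.mem_Icc]
    constructor
    · refine Nat.one_le_iff_ne_zero.2 fun h0 => ?_
      rw [h0, mul_zero, zero_add] at hdm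
      omega
    · have : W * (m / W) ≤ W * N := by omega
      exact Nat.le_of_mul_le_mul_left this hW
  · intro n _
    show (W * n + b) / W = n
    rw [Nat.mul_add_div hW, Nat.div_eq_of_lt hb, add_zero]
  · intro m hm
    rw [Finset.mem_filter, Finset.mem_Ioc] at hm
    obtain ⟨-, hdvd⟩ := hm
    have hmod : m % W = b := by
      have h := (Nat.modEq_iff_dvd.2 hdvd : b ≡ m [MOD W])
      rw [Nat.ModEq, Nat.mod_eq_of_lt hb] at h
      exact h.symm
    show W * (m / W) + b = m
    conv_rhs => rw [← Nat.div_add_mod m W]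
    rw [hmod]
  · intro n _
    have : (((W * n + b : ℕ) : ℝ) - b) * α / W = (n : ℝ) * α := by
      push_cast; field_simp; ring
    rw [this]

/-- `primeExpSumLog X θ = ∑_{0 < m ≤ X} Λ'(m) e(mθ)`. [folklore] -/
theorem primeExpSumLog_eq_sum_Ioc (X : ℕ) (θ : ℝ) :
    primeExpSumLog X θ = ∑ m ∈ Ioc 0 X, (vonMangoldtPrime m : ℂ) * (𝐞 ((m : ℝ) * θ) : ℂ) := by
  rw [primeExpSumLog, Nat.primesLE_eq_filter_Icc_one, Finset.sum_filter]
  have : Icc 1 X = Ioc 0 X := by ext m; simp only [Finset.mem_Icc, Finset.mem_Ioc]; omega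
  rw [this]
  refine Finset.sum_congr rfl fun m _ => ?_
  unfold vonMangoldtPrime
  split_ifs <;> simp

/-- **The window against Vinogradov's sum**: `‖windowSum W b N θ‖ ≤ ‖primeExpSumLog (WN+b) θ‖ + (log 4) b`
(the head `0 < m ≤ b` has `∑ Λ' = ϑ(b) ≤ b log 4`, Mathlib's `Chebyshev.theta_le_log4_mul_x`). [folklore] -/
theorem norm_windowSum_le (W b N : ℕ) (θ : ℝ) :
    ‖windowSum W b N θ‖ ≤ ‖primeExpSumLog (W * N + b) θ‖ + Real.log 4 * b := by
  set f : ℕ → ℂ := fun m => (vonMangoldtPrime m : ℂ) * (𝐞 ((m : ℝ) * θ) : ℂ) with hf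
  have hsplit : ∑ m ∈ Ioc 0 b, f m + windowSum W b N θ = primeExpSumLog (W * N + b) θ := by
    rw [primeExpSumLog_eq_sum_Ioc, windowSum]
    exact Finset.sum_Ioc_consecutive f (Nat.zero_le b) (by omega)
  have hhead : ‖∑ m ∈ Ioc 0 b, f m‖ ≤ Real.log 4 * b := by
    calc ‖∑ m ∈ Ioc 0 b, f m‖ ≤ ∑ m ∈ Ioc 0 b, ‖f m‖ := norm_sum_le _ _
      _ = ∑ m ∈ Ioc 0 b, vonMangoldtPrime m := by
          refine Finset.sum_congr rfl fun m _ => ?_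
          rw [hf, norm_mul, Circle.norm_coe, mul_one, Complex.norm_real,
            Real.norm_of_nonneg (vonMangoldtPrime_le_vonMangoldt m).1]
      _ = Chebyshev.theta b := by
          rw [Chebyshev.theta, Nat.floor_natCast, Finset.sum_filter]
          refine Finset.sum_congr rfl fun m _ => ?_
          unfold vonMangoldtPrime
          split_ifs <;> simp
      _ ≤ Real.log 4 * b := Chebyshev.theta_le_log4_mul_x (Nat.cast_nonneg b)
  have : windowSum W b N θ = primeExpSumLog (W * N + b) θ - ∑ m ∈ Ioc 0 b, f m := by
    rw [← hsplit]; ring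
  rw [this]
  exact (norm_sub_le _ _).trans (add_le_add le_rfl hhead)

/-- **The minor-arc inequality for the `W`-tricked primes.** For `0 ≤ b < W`, if
`‖∑_{p ≤ WN+b} (log p) e(p(α+j)/W)‖ ≤ B` for all `0 ≤ j < W`, then
`‖∑_{n ≤ N} Λ'(Wn+b) e(nα)‖ ≤ B + (log 4) b` (hence `‖∑_{n ≤ N} Λ'_{b,W}(n) e(nα)‖ ≤ B + (log 4) b`
as `φ(W)/W ≤ 1`). The hypothesis is furnished on minor arcs by Vinogradov's estimate
`Literature.NumberTheory.Sieve.Vinogradov.vinogradov_primeExpSumLog_bound`.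
[cite: GreenTao2010, §12 (case `s = 1`: "the classical Hardy–Littlewood method")] -/
theorem norm_progExpSum_le {W b N : ℕ} (hW : 0 < W) (hb : b < W) (α : ℝ) {B : ℝ}
    (hB : ∀ j ∈ range W, ‖primeExpSumLog (W * N + b) ((α + j) / W)‖ ≤ B) :
    ‖progExpSum W b N α‖ ≤ B + Real.log 4 * b := by
  have hW0 : (0 : ℝ) < W := by exact_mod_cast hW
  rw [progExpSum_eq hW hb N α, norm_mul]
  have hn : ‖(1 / W : ℂ)‖ = 1 / W := by
    rw [norm_div, norm_one, Complex.norm_natCast]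
  rw [hn]
  calc 1 / (W : ℝ) * ‖∑ j ∈ range W, (𝐞 (-((b : ℝ) * (α + j) / W)) : ℂ) * windowSum W b N ((α + j) / W)‖
      ≤ 1 / (W : ℝ) * ∑ j ∈ range W, (B + Real.log 4 * b) := by
        gcongr
        refine (norm_sum_le _ _).trans (Finset.sum_le_sum fun j hj => ?_)
        rw [norm_mul, Circle.norm_coe, one_mul]
        exact (norm_windowSum_le W b N _).trans (add_le_add (hB j hj) le_rfl)
    _ = B + Real.log 4 * b := by
        rw [Finset.sum_const, Finset.card_range, nsmul_eq_mul]
        field_simp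

/-- The same for `Λ'_{b,W}`: `‖∑_{n ≤ N} Λ'_{b,W}(n) e(nα)‖ ≤ B + (log 4) b`. [folklore] -/
theorem norm_sum_vonMangoldtW_mul_le {W b N : ℕ} (hW : 0 < W) (hb : b < W) (α : ℝ) {B : ℝ}
    (hB : ∀ j ∈ range W, ‖primeExpSumLog (W * N + b) ((α + j) / W)‖ ≤ B) :
    ‖∑ n ∈ Icc 1 N, (vonMangoldtW W b n : ℂ) * (𝐞 ((n : ℝ) * α) : ℂ)‖ ≤ B + Real.log 4 * b := by
  have hW0 : (0 : ℝ) < W := by exact_mod_cast hW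
  have h := norm_progExpSum_le hW hb α hB
  have hB0 : 0 ≤ B + Real.log 4 * b := (norm_nonneg _).trans h
  rw [sum_vonMangoldtW_mul_eq, norm_mul, Complex.norm_real, Real.norm_of_nonneg (by positivity)]
  have hρ : (Nat.totient W : ℝ) / W ≤ 1 := by
    rw [div_le_one hW0]; exact_mod_cast Nat.totient_le W
  calc (Nat.totient W : ℝ) / W * ‖progExpSum W b N α‖ ≤ 1 * (B + Real.log 4 * b) :=
        mul_le_mul hρ h (norm_nonneg _) zero_le_one
    _ = B + Real.log 4 * b := one_mul _

/-! ### The linear exponential sum -/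

/-- `‖∑_{n ≤ N} e(nα)‖ · ‖α‖_{ℝ/ℤ} ≤ 1/2` (`Vinogradov.norm_sum_Ioc_fourierChar_mul_distInt_le`
on `(0, N]`). [folklore] -/
theorem norm_sum_Icc_fourierChar_mul_distInt_le (N : ℕ) (α : ℝ) :
    ‖∑ n ∈ Icc 1 N, (𝐞 ((n : ℝ) * α) : ℂ)‖ * Vinogradov.distInt α ≤ 1 / 2 := by
  have : Icc 1 N = Ioc 0 N := by ext m; simp only [Finset.mem_Icc, Finset.mem_Ioc]; omega
  rw [this]
  exact Vinogradov.norm_sum_Ioc_fourierChar_mul_distInt_le 0 N α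

end WTrick

end Literature.NumberTheory.Sieve
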